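import Summits.BirchSwinnertonDyer.BirchSwinnertonDyer.Theorems.PrintX9HowardContainmentOfPrintStubRescaling
import Literature.NumberTheory.EllipticCurves.HeegnerEnvelopeCoherentPairProofs
import Literature.NumberTheory.EllipticCurves.HeegnerGeomCoherentDataOfFrameProofs
import Literature.NumberTheory.EllipticCurves.HeegnerCharIdealEnvelopePowTransferProofs
import Literature.NumberTheory.EllipticCurves.AnticyclotomicTowerSharpProofs
import Literature.NumberTheory.EllipticCurves.CastellaGrossiSkinner2025.HeegnerKolyvaginBoundAnyClassNumberProofs
import HarnessLib

/-!
# The UNTIED Howard containment `∃ F, I(ℋ_∞(F))² ⊆ char_Λ(X_tors)` from CGLS 2022 Thm. 4.1.1 and CGS 2025 Thm. 6.5.2,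
# CLASS-FREE and ROUTE-FREE: every frame satisfying `CastellaGrossiLeeSkinner2022.Thm413Hypotheses` with `p` split in
# `K` and `p ∤ N_E` — ANY class number, ANY torsion depth, ANY Selmer corank, ANY odd `p`

Cell `pub/bsd-print-x9`, seat `bsd-line-x10b-p2` (LEAD g11), write-crux stmt-BirchSwinnertonDyer-23729
`PrintX10b.HowardContainmentAnyClassNumberX10b` (aside r303). This module is the route-free CORE of the scaling
reduction that the x9-p1 LEAD ran on light X9 frames (`PrintX9OfPrintNonvanishing.howardContainmentLightFrame_of_
nonvanishing_of_cgs`, p681863) and that this seat runs on odd-`d_K` X10b frames (consumer file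
`PrintX10bHowardContainmentAnyClassNumberX10bOfPrintOddDisc.lean`, a `Theses.PrintX10b` importer): it imports NO route file,
takes the two printed theorems as the Literature named facts they are
(`thm411_torsionFree_heegnerClass_ne_bot_quotient_isTorsion.{0}`, `thm652_stabilized_rankOne_charIdeal_torsion_dvd_pLocalized.{0}`
— definitionally the route leaves `CGLSHeegnerClassNonvanishing` / `CGSHowardDivisibilityPLocalized` of PrintX9 and PrintX10b),
and takes the frame through the hypothesis record `Thm413Hypotheses (W.conductorNorm ℤ) W K p κ γ` itself plus the two
binders the coherent pair needs beyond it: `p` SPLIT in `K` (`SatisfiesHeegnerHypothesis p K`, for `[K[p] : K[1]] = p − 1`)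
and `p ∤ N_E`.

* `howardContainment_untied_of_thm411_of_thm652` — for a GIVEN `jbar`, parametrisation datum `Dt` and Heegner datum `H`:
  `∃ D F X, I(ℋ_∞(F))² ⊆ char_Λ(X_{Λ-tors})`. PROOF (every step a tree theorem): the COHERENT PAIR `(C, F₀)` on
  `(Dt, H.β)` with `ℋ_∞(F₀) ≤ Λκ_∞(C)` and `g • Λκ_∞(C) ≤ ℋ_∞(F₀)`, `g ≠ 0` (`exists_coherent_pair_envelope`, over the
  THEOREM `anticyclotomicTowerSharp` — `K_k ⊆ K[p^{k+1}]` at every class number — and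
  `card_ringClassGalOver_prime_one_of_frame`); `𝔖` f.g. of `Λ`-rank one and `(p^m)·I(Λκ_∞(C))² ⊆ char(X_tors)` (Thm.
  6.5.2, `span_pow_mul_sq_le_charIdeal_torsion_of_thm652_stabilized`); `𝔖/Λκ_∞(C)` torsion (Thm. 4.1.1,
  `isTorsion_quotient_stabilizedHeegnerModule_of_thm411`), hence `𝔖/ℋ_∞(F₀)` torsion (reverse envelope) and
  `(p^n)·I(ℋ_∞(F₀)) ⊆ I(Λκ_∞(C))` (forward envelope); so `(p^{m+2n})·I(ℋ_∞(F₀))² ⊆ char(X_tors)`; and the μ-BLIND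
  PROMOTION `PrintX9Rescaling.howardContainment_of_localized_family` answers with the rescaled family `F := p^{m+2n} • F₀`,
  its input «`E(K_n)[p] = 0` along the tower» being `fixedGeomPoints_eq_zero_of_smul_eq_zero_of_noPTorsion` fed by (h1)
  `E(K)[p] = 0` (a field of the record). NO residual irreducibility over `K`, NO rank / `Ш` binder, NO `μ`-statement, NO
  Howard / Mastella–Zerman input, NO corank-one "Moreover" clause of CGLS Thm. 4.1.3.
* `howardContainment_untied_localized_of_thm411_of_thm652` — the same package BEFORE promotion, for the record:
  `∃ D F X m, (p^m)·I(ℋ_∞(F))² ⊆ char`, `𝔖/ℋ_∞(F)` torsion, `F.Dt = Dt`, `F.β = H.β` (the PINNED localized containment: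
  here the family IS the frame's own; only the promotion un-pins it).

HONEST FRAMING. Kernel-valid AS TYPED, CONDITIONAL on the two cite-only print facts (both `def … : Prop`, nothing
asserted); per the cell's FINDING PIN-1 / ruling R0 the untied `∃ F` does not pin the parametrisation — the first theorem
is the kernel witness that untied containments are μ-BLIND wherever CGLS/CGS print reaches (odd `d_K ≠ -3`, `p ∤ 2N`
good ordinary, `p` split); it is NOT route currency. «beyond-print theorem»: no. No summit statement is proved; BSD is
NOT proved by any of this.

References: [CastellaGrossiLeeSkinner2022] Thm. 4.1.1, Thm. 4.1.3, Rem. 4.1.4, §3.2/§4.1 standing hypotheses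
(arXiv:2008.02571v2 TeX L1253–1262, L2186–2294); [CastellaGrossiSkinner2025] Thm. 6.5.2 (Math. Ann. 393, final TeX
l.3229–3238); [Howard2004HeegnerKolyvagin] §1 ("Fixing a modular parametrization"), §3.3, Thm. B; [PerrinRiou1987BSMF]
§1 p. 405, §3.2–3.4; [Cornut2002] (Mazur's conjecture, the source of `κ₁^{Hg} ≠ 0`).
-/

set_option linter.dupNamespace false
set_option autoImplicit false

noncomputable section

open scoped Classical Pointwise
open WeierstrassCurve Literature.NumberTheory.EllipticCurves
  Literature.NumberTheory.EllipticCurves.ModularForms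
  Literature.NumberTheory.EllipticCurves.CastellaGrossiLeeSkinner2022

namespace Summit.BirchSwinnertonDyer.BirchSwinnertonDyer.Theorems.UntiedHowardContainmentOfPrint

/-- Ideal bookkeeping: `(a) · ((b) · I)² = (a·b²) · I²`. [folklore] -/
private theorem span_singleton_mul_sq {R : Type*} [CommSemiring R] (a b : R) (I : Ideal R) :
    Ideal.span {a} * (Ideal.span {b} * I) ^ 2 = Ideal.span {a * b ^ 2} * I ^ 2 := by
  rw [mul_pow, Ideal.span_singleton_pow, ← mul_assoc, Ideal.span_singleton_mul_span_singleton]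

/-- **The PINNED `p`-localized Howard containment from CGLS 2022 Thm. 4.1.1 and CGS 2025 Thm. 6.5.2**, class-free and
route-free: on a frame satisfying `Thm413Hypotheses (W.conductorNorm ℤ) W K p κ γ` with `p` split in `K` and `p ∤ N_E`,
for every embedding `jbar`, parametrisation datum `Dt` and Heegner datum `H` there are a `Λ`-adic Selmer datum `D`, a
Heegner family `F` ON `(Dt, H.β)`, a Selmer dual `X` and `m : ℕ` with `𝔖` finitely generated of `Λ`-rank one,
`𝔖/ℋ_∞(F)` torsion and `(p^m) · I(ℋ_∞(F))² ⊆ char_Λ(X_{Λ-tors})` — the coherent pair `(C, F)` on `(Dt, H.β)`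
(`exists_coherent_pair_envelope` over the theorem `anticyclotomicTowerSharp`), torsion of `𝔖/Λκ_∞(C)` (Thm. 4.1.1) moved
along the reverse envelope, the forward envelope `(p^n)·I(ℋ_∞(F)) ⊆ I(Λκ_∞(C))`, and Thm. 6.5.2's
`(p^{m'})·I(Λκ_∞(C))² ⊆ char`. ANY class number, torsion depth and Selmer corank.
[cite: CastellaGrossiLeeSkinner2022, Thm. 4.1.1 and Rem. 4.1.4 (arXiv:2008.02571v2 TeX L2203–2294)]
[cite: CastellaGrossiSkinner2025, Thm. 6.5.2 (final TeX l.3229–3238)] [cite: PerrinRiou1987BSMF, §3.4 Prop. 10] -/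
theorem howardContainment_untied_localized_of_thm411_of_thm652
    (h411 : thm411_torsionFree_heegnerClass_ne_bot_quotient_isTorsion.{0})
    (h652 : CastellaGrossiSkinner2025.thm652_stabilized_rankOne_charIdeal_torsion_dvd_pLocalized.{0})
    {W : WeierstrassCurve ℚ} [W.IsGloballyMinimal] [NeZero (W.conductorNorm ℤ)] {p : ℕ} [Fact p.Prime]
    {K : Type} [Field K] [NumberField K] {κ : ZpExtension K p} {γ : Field.absoluteGaloisGroup K}
    (hyp : Thm413Hypotheses (W.conductorNorm ℤ) W K p κ γ) (hHp : SatisfiesHeegnerHypothesis p K)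
    (hpN : ¬ p ∣ W.conductorNorm ℤ) (jbar : AlgebraicClosure K →+* ℂ)
    (Dt : ModularParametrizationData W (W.conductorNorm ℤ)) (H : HeegnerDatum (W.conductorNorm ℤ) (NumberField.discr K)) :
    ∃ (D : (W.baseChange K).LambdaAdicSelmerData κ γ) (F : HeegnerFamily (W.conductorNorm ℤ) W K κ jbar)
      (X : (W.baseChange K).SelmerDualData κ γ) (m : ℕ),
      F.Dt = Dt ∧ F.β = H.β ∧
      Module.Finite (IwasawaAlgebra p) D.S ∧ Module.finrank (IwasawaAlgebra p) D.S = 1 ∧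
      Module.IsTorsion (IwasawaAlgebra p) (D.S ⧸ heegnerModule D F) ∧
      Ideal.span {((p : IwasawaAlgebra p) ^ m)} * heegnerCharIdeal D F ^ 2 ≤
        Module.charIdeal (IwasawaAlgebra p) (Submodule.torsion (IwasawaAlgebra p) X.X) := by
  haveI : W.IsElliptic := hyp.isElliptic
  have hp : p.Prime := Fact.out
  have hp_odd : Odd p := hp.odd_of_ne_two hyp.p_ne_two
  have hK : IsImaginaryQuadratic K := hyp.isImaginaryQuadratic
  -- the data `𝔖`, `X`
  obtain ⟨D⟩ := LambdaAdicSelmerDataExists.nonempty_lambdaAdicSelmerData (W.baseChange K) p κ hyp.topGenerator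
  obtain ⟨X⟩ := (W.baseChange K).nonempty_selmerDualData_holds κ γ hyp.topGenerator
  -- the coherent pair on `(Dt, H.β)` with its module-level envelope (tower = the theorem `anticyclotomicTowerSharp`)
  obtain ⟨C, F, -, hFDt, -, hFβ, hfwd, g, hg, hrev⟩ :=
    exists_coherent_pair_envelope (W := W) hK hyp.heegner Dt H.dvd_sq_sub jbar hyp.ordinary hpN κ hyp.topGenerator
      (fun k ↦ anticyclotomicTowerSharp K p hp_odd hK κ hyp.anticyclotomic jbar k)
      (card_ringClassGalOver_prime_one_of_frame hK hyp.discr_odd hyp.discr_ne hp hHp jbar) hyp.noPTorsion D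
  have hfwd' : ((p : IwasawaAlgebra p) ^ 0) • heegnerModule D F ≤ stabilizedHeegnerModule D C := by
    rw [pow_zero, one_smul]
    exact hfwd
  -- Thm. 6.5.2: `𝔖` f.g. of `Λ`-rank one and `(p^m') · I(Λκ_∞(C))² ⊆ char(X_tors)`
  obtain ⟨⟨hSfin, hS1⟩, -⟩ := h652 (W.conductorNorm ℤ) W K p κ γ jbar hyp D C X
  haveI : Module.Finite (IwasawaAlgebra p) D.S := hSfin
  obtain ⟨m, hm⟩ := CastellaGrossiSkinner2025.span_pow_mul_sq_le_charIdeal_torsion_of_thm652_stabilized h652 hyp D C X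
  -- Thm. 4.1.1: `𝔖/Λκ_∞(C)` torsion, moved to `𝔖/ℋ_∞(F)` along the reverse envelope; forward envelope on ideals
  have htorC : Module.IsTorsion (IwasawaAlgebra p) (D.S ⧸ stabilizedHeegnerModule D C) :=
    isTorsion_quotient_stabilizedHeegnerModule_of_thm411 h411 hyp D C
  have htorF : Module.IsTorsion (IwasawaAlgebra p) (D.S ⧸ heegnerModule D F) :=
    isTorsion_quotient_heegnerModule_of_smul_stabilizedHeegnerModule_le D F C hg hrev htorC
  obtain ⟨n, henv⟩ :=
    exists_span_pow_mul_heegnerCharIdeal_le_stabilizedHeegnerCharIdeal_of_pow_smul_le D F C 0 hfwd' htorF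
  refine ⟨D, F, X, m + n * 2, hFDt, hFβ, hSfin, hS1, htorF, ?_⟩
  calc Ideal.span {((p : IwasawaAlgebra p) ^ (m + n * 2))} * heegnerCharIdeal D F ^ 2
      = Ideal.span {((p : IwasawaAlgebra p) ^ m)} *
          (Ideal.span {((p : IwasawaAlgebra p) ^ n)} * heegnerCharIdeal D F) ^ 2 := by
        rw [span_singleton_mul_sq, ← pow_mul, ← pow_add]
    _ ≤ Ideal.span {((p : IwasawaAlgebra p) ^ m)} * stabilizedHeegnerCharIdeal D C ^ 2 :=
        Ideal.mul_mono_right (Ideal.pow_right_mono henv 2)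
    _ ≤ _ := hm

/-- **THE UNTIED HOWARD CONTAINMENT from CGLS 2022 Thm. 4.1.1 and CGS 2025 Thm. 6.5.2, class-free and route-free.**
On every frame satisfying `Thm413Hypotheses (W.conductorNorm ℤ) W K p κ γ` (`E/ℚ` at its own level, `p ≠ 2` good
ordinary, `K` imaginary quadratic with `p ∤ d_K`, (h1) `E(K)[p] = 0`, (Heeg), `d_K` odd and `≠ -3`, `κ` anticyclotomic
with topological generator `γ`) with `p` SPLIT in `K` and `p ∤ N_E`, for every `jbar`, `Dt`, `H`: there are `D`, a
Heegner family `F` and `X` with `I(ℋ_∞(F))² ⊆ char_Λ(X_{Λ-tors})` — Howard's Thm. B containment in its `∃ F` (UNTIED)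
shape at ANY class number, torsion depth and Selmer corank. From `howardContainment_untied_localized_of_thm411_of_thm652`
by the μ-blind promotion `PrintX9Rescaling.howardContainment_of_localized_family` (`F := p^m • F₀`), whose tower input
«`E(K_n)[p] = 0`» is `fixedGeomPoints_eq_zero_of_smul_eq_zero_of_noPTorsion` fed by (h1), and whose non-torsion
element of `ℋ_∞(F₀)` is rank bookkeeping (`exists_nonTorsion_mem_of_finrank_eq_one`). NOT route currency (PIN-1 / R0:
the `F` produced is a rescaled family, not the frame's own). [cite: CastellaGrossiLeeSkinner2022, Thm. 4.1.1, Rem. 4.1.4, §3.2 (h1)]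
[cite: CastellaGrossiSkinner2025, Thm. 6.5.2] [cite: Howard2004HeegnerKolyvagin, §1 ("Fixing a modular parametrization"), Thm. B]
[cite: PerrinRiou1987BSMF, §1 p. 405 (H_∞ depends on the parametrisation π)] -/
theorem howardContainment_untied_of_thm411_of_thm652
    (h411 : thm411_torsionFree_heegnerClass_ne_bot_quotient_isTorsion.{0})
    (h652 : CastellaGrossiSkinner2025.thm652_stabilized_rankOne_charIdeal_torsion_dvd_pLocalized.{0})
    {W : WeierstrassCurve ℚ} [W.IsGloballyMinimal] [NeZero (W.conductorNorm ℤ)] {p : ℕ} [Fact p.Prime]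
    {K : Type} [Field K] [NumberField K] {κ : ZpExtension K p} {γ : Field.absoluteGaloisGroup K}
    (hyp : Thm413Hypotheses (W.conductorNorm ℤ) W K p κ γ) (hHp : SatisfiesHeegnerHypothesis p K)
    (hpN : ¬ p ∣ W.conductorNorm ℤ) (jbar : AlgebraicClosure K →+* ℂ)
    (Dt : ModularParametrizationData W (W.conductorNorm ℤ)) (H : HeegnerDatum (W.conductorNorm ℤ) (NumberField.discr K)) :
    ∃ (D : (W.baseChange K).LambdaAdicSelmerData κ γ) (F : HeegnerFamily (W.conductorNorm ℤ) W K κ jbar)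
      (X : (W.baseChange K).SelmerDualData κ γ),
      heegnerCharIdeal D F ^ 2 ≤
        Module.charIdeal (IwasawaAlgebra p) (Submodule.torsion (IwasawaAlgebra p) X.X) := by
  haveI : W.IsElliptic := hyp.isElliptic
  obtain ⟨D, F₀, X, m, -, -, hSfin, hS1, htorF, hm⟩ :=
    howardContainment_untied_localized_of_thm411_of_thm652 h411 h652 hyp hHp hpN jbar Dt H
  haveI : Module.Finite (IwasawaAlgebra p) D.S := hSfin
  obtain ⟨F, hF⟩ := PrintX9Rescaling.howardContainment_of_localized_family D X F₀ m hSfin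
    (fun n P hP hpP ↦ PrintX9Rescaling.fixedGeomPoints_eq_zero_of_smul_eq_zero_of_noPTorsion (W.baseChange K) κ
      hyp.noPTorsion n hP hpP)
    htorF (PrintX9Rescaling.exists_nonTorsion_mem_of_finrank_eq_one hS1 (heegnerModule D F₀) htorF) hm
  exact ⟨D, F, X, hF⟩

end Summit.BirchSwinnertonDyer.BirchSwinnertonDyer.Theorems.UntiedHowardContainmentOfPrint

end
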